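import Literature.MathematicalPhysics.QuantumLattice.DWaveSourceWindowHamiltonian
import Literature.MathematicalPhysics.QuantumLattice.HubbardTorusLocalCertificate
import HarnessLib

/-!
# Window certificates for the energy per site of the `d`-wave pair-sourced Hubbard torus

Topic `MathematicalPhysics/QuantumLattice` (sequel of `DWaveSourceWindowHamiltonian.lean`; the
particle-number-conserving analogue is `HubbardWindowCertificate.lean`).

SOUNDNESS THEOREM ONLY. For the pair-sourced grand-canonical Hubbard Hamiltonian
`A_L = H_L(1,U) − μ N_L − h (Δ_L + Δ_Lᴴ)` on the `L × L` torus (`dWaveSourceTorus L U μ h`, Koma–Tasaki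
1994 §1) we prove that ONE operator identity in the CAR algebra `𝔄_{Λ'}` of a finite window
`Λ' ⊆ ℤ²` — a translation-invariant bootstrap / sum-of-squares certificate in the sense of Han (2020,
§3: positivity of a Gram form, stationarity `⟨[H,O]⟩ = 0`, symmetry `⟨U O U⁻¹⟩ = ⟨O⟩`, conserved
charges) for the local objective `E_Φ(1,U) − μ Σ_σ n_{0σ} − h (Δ₀ + Δ₀ᴴ)` with constant `c` and
ladder-word residual `Σ aₖ vₖ` — bounds the ground-state energy of `A_L` on the FULL Fock space of
EVERY torus of side `L ≥ 3` on which `x ↦ x mod L` is injective on `thicken Λ' 1`: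
`(c − Σₖ ‖aₖ‖) · L² ≤ E₀(A_L)` (`dWaveSourceTorus_groundEnergy_ge_of_window_certificate`), hence for
all `L ≥ L₀(Λ')` (`…_eventually`). Because the pair source breaks particle-number conservation, the
sector is the whole space (`K = ⊤` in `Matrix.mul_card_le_minEnergyOn_of_local_certificate`), the
admissible charged null words are the `S^z`-charged ones only, and the symmetry family is the torus
translations (no `C₄`: the `d`-wave source is odd under the quarter turn).

Ingredients (this file): graded locality of `A_L` seen from an inner region
(`dWaveSourceTorus_commutator_fermionEmbed`: `[A_L, Γ B] = Γ [H^src_{Λ'}, B]`, Bratteli–Robinson II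
§5.2.2), the translates of the pulled-back objective summing to `A_L`
(`sum_conj_fockTranslate_pairSourceObjective`, ibid. §6.2.4), translation and `S^z` invariance and
hermiticity of `A_L`.

Scope and honest status. No certificate is constructed or asserted to exist here, and nothing in this
file bears on `d`-wave order of the Hubbard model: the theorem is the finite-volume reading of a
would-be certified lower bound `e_lo(h) · L² ≤ E₀(A_L)`, the `hlo` input of the conditional
order-parameter ceiling `s²/(2h²)` (`Summit.HubbardSuperconductivity.HubbardLadder.PairSourceEnergySlack`).
Point-group reductions and the particle-number-charged null words of the `h = 0` theory are not covered.
-/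

noncomputable section

namespace Literature.MathematicalPhysics.QuantumLattice

open Matrix Finset HubbardWave0 Literature.Probability.LatticeModels
open Literature.MathematicalPhysics.QuantumManyBody.StateRelaxation
open scoped ComplexOrder BigOperators

section Window

variable (g : Site 2 → ℝ) (L : ℕ) [NeZero L]

/-! ### Locality of the sourced torus Hamiltonian seen from an inner region -/

/-- **`A_L − Γ(H^src_{Λ'})` is even and supported off `Γ(𝔄_Λ)`** (`A_L = dWaveSourceTorus L U μ h`,
`g = dWaveFormFactor`; hypotheses as in `hubbardTorus_sub_fermionEmbed_localHamiltonian_mem_carEvenSubalgebra`).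
[cite: BratteliRobinsonII1997, §6.2.1 and §5.2.2] -/
theorem dWaveSourceTorus_sub_fermionEmbed_mem_carEvenSubalgebra {Λ Λ' : Finset (Site 2)} (hΛ : Λ ⊆ Λ')
    (hclosed : ∀ x ∈ Λ, ∀ i : Fin 2, x + unitVec i ∈ Λ' ∧ x - unitVec i ∈ Λ')
    (hInj : Set.InjOn (Torus.proj (d := 2) L) ↑(thicken Λ' 1)) (U μ h : ℝ) :
    dWaveSourceTorus L U μ h -
        fermionEmbed (PolySite.toTorusEmb L (hInj.mono (by exact_mod_cast subset_thicken Λ' 1)))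
          (pairSourceWindowHamiltonian dWaveFormFactor Λ' U μ h) ∈
      carEvenSubalgebra (orbs (Λ.image fun x => FermionTorus.ofTorusSite (Torus.proj L x)))ᶜ := by
  have hInj' : Set.InjOn (Torus.proj (d := 2) L) ↑Λ' := hInj.mono (by exact_mod_cast subset_thicken Λ' 1)
  set Γ' := fermionEmbed (PolySite.toTorusEmb L hInj') with hΓ'
  -- written additively: only the additive and scalar structure of the subalgebra is used below
  have e : dWaveSourceTorus L U μ h - Γ' (pairSourceWindowHamiltonian dWaveFormFactor Λ' U μ h) =
      (hubbardTorus 2 L 1 U - Γ' ((hubbardFermionInteraction 2 1 U).localHamiltonian Λ')) +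
        (-(μ : ℂ)) • (totalNumber - Γ' (totalNumber : FermionOp Λ')) +
        (-(h : ℂ)) • ((pairField dWaveFormFactor L - Γ' (pairSourceWindow dWaveFormFactor Λ')) +
          (pairField dWaveFormFactor L - Γ' (pairSourceWindow dWaveFormFactor Λ'))ᴴ) := by
    rw [dWaveSourceTorus, hubbardTorusWith_eq, pairSourceWindowHamiltonian, fermionEmbed_sub, fermionEmbed_sub, fermionEmbed_smul,
      fermionEmbed_smul, fermionEmbed_add, fermionEmbed_conjTranspose, conjTranspose_sub]
    simp only [smul_sub, smul_add, neg_smul]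
    abel
  rw [e]
  exact add_mem (add_mem (hubbardTorus_sub_fermionEmbed_localHamiltonian_mem_carEvenSubalgebra L 1 U hΛ hclosed hInj)
    (SMulMemClass.smul_mem _ (totalNumber_sub_fermionEmbed_totalNumber_mem L hΛ hInj')))
    (SMulMemClass.smul_mem _ (add_mem
      (pairField_sub_fermionEmbed_pairSourceWindow_mem dWaveFormFactor L hΛ hclosed hInj)
      (pairField_sub_fermionEmbed_pairSourceWindow_conjTranspose_mem dWaveFormFactor L hΛ hclosed hInj)))

/-- **Locality of the sourced torus Hamiltonian seen from an inner region**: for `B ∈ 𝔄_Λ`,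
`[A_L, Γ(B)] = Γ([H^src_{Λ'}, B])` — the commutator of the pair-sourced torus Hamiltonian with an
observable of the inner region is the pull-back of its commutator with the sourced WINDOW Hamiltonian.
This makes Han's stationarity constraints `⟨[H, O]⟩ = 0` (2020, §3), computed in the window, exact
identities on every large torus. [cite: Han2020Bootstrap, §3] -/
theorem dWaveSourceTorus_commutator_fermionEmbed {Λ Λ' : Finset (Site 2)} (hΛ : Λ ⊆ Λ')
    (hclosed : ∀ x ∈ Λ, ∀ i : Fin 2, x + unitVec i ∈ Λ' ∧ x - unitVec i ∈ Λ')
    (hInj : Set.InjOn (Torus.proj (d := 2) L) ↑(thicken Λ' 1)) (U μ h : ℝ) (A : FermionOp Λ) :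
    dWaveSourceTorus L U μ h *
          fermionEmbed (PolySite.toTorusEmb L (hInj.mono (by exact_mod_cast subset_thicken Λ' 1)))
            (fermionEmbed (PolySite.incl hΛ) A) -
        fermionEmbed (PolySite.toTorusEmb L (hInj.mono (by exact_mod_cast subset_thicken Λ' 1)))
            (fermionEmbed (PolySite.incl hΛ) A) * dWaveSourceTorus L U μ h =
      fermionEmbed (PolySite.toTorusEmb L (hInj.mono (by exact_mod_cast subset_thicken Λ' 1)))
        (pairSourceWindowHamiltonian dWaveFormFactor Λ' U μ h * fermionEmbed (PolySite.incl hΛ) A -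
          fermionEmbed (PolySite.incl hΛ) A * pairSourceWindowHamiltonian dWaveFormFactor Λ' U μ h) := by
  have hInj' : Set.InjOn (Torus.proj (d := 2) L) ↑Λ' := hInj.mono (by exact_mod_cast subset_thicken Λ' 1)
  have hc : Commute (dWaveSourceTorus L U μ h -
      fermionEmbed (PolySite.toTorusEmb L hInj') (pairSourceWindowHamiltonian dWaveFormFactor Λ' U μ h))
      (fermionEmbed (PolySite.toTorusEmb L hInj') (fermionEmbed (PolySite.incl hΛ) A)) := by
    rw [fermionEmbed_fermionEmbed]
    refine commute_of_mem_carEvenSubalgebra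
      (dWaveSourceTorus_sub_fermionEmbed_mem_carEvenSubalgebra L hΛ hclosed hInj U μ h)
      (fermionEmbed_mem_carSubalgebra _ A) ?_
    exact disjoint_compl_left_iff.2 (orbs_map_incl_trans_toTorusEmb_subset L hΛ _)
  rw [Commute, SemiconjBy, sub_mul, mul_sub, sub_eq_sub_iff_sub_eq_sub] at hc
  rw [fermionEmbed_sub, fermionEmbed_mul, fermionEmbed_mul]
  exact hc

/-! ### Translates of the local objective; symmetries of the sourced torus Hamiltonian -/

/-- **The translates of the sourced local objective sum to the sourced torus Hamiltonian** (`L ≥ 3`):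
with `E^src = Γ(incl) E_Φ(1,U) − μ Σ_σ n_{0σ} − h (Γ(incl) Δ₀ + (Γ(incl) Δ₀)ᴴ) ∈ 𝔄_{Λ'}`
(`Δ₀ = localPairAt {0,±e₁,±e₂} g 0`), `Σ_{v ∈ (ℤ/L)²} U_v Γ(E^src) U_vᴴ = H_L(1,U) − μ N_L − h (Δ_g + Δ_gᴴ)`.
Bratteli–Robinson II §6.2.4 (periodic boxes); for `g = dWaveFormFactor` the right side is
`dWaveSourceTorus L U μ h`. [cite: BratteliRobinsonII1997, §6.2.4] -/
theorem sum_conj_fockTranslate_pairSourceObjective {Λ' : Finset (Site 2)}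
    (h0 : thicken ({0} : Finset (Site 2)) 1 ⊆ Λ') (hz : (0 : Site 2) ∈ Λ')
    (hP : pairRegion (insert (0 : Site 2) unitSteps) 0 ⊆ Λ')
    (hInj' : Set.InjOn (Torus.proj (d := 2) L) ↑Λ') (hL : 3 ≤ L) (U μ h : ℝ) :
    ∑ v : TorusSite 2 L, (fockTranslate v).val *
        fermionEmbed (PolySite.toTorusEmb L hInj')
          (fermionEmbed (PolySite.incl h0) ((hubbardFermionInteraction 2 1 U).meanEnergyObs 1) -
            (μ : ℂ) • ∑ σ : Fin 2, nAt 0 hz σ -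
            (h : ℂ) • (fermionEmbed (PolySite.incl hP) (localPairAt (insert (0 : Site 2) unitSteps) g 0) +
              (fermionEmbed (PolySite.incl hP) (localPairAt (insert (0 : Site 2) unitSteps) g 0))ᴴ)) *
        (fockTranslate v).valᴴ =
      hubbardTorusWith 2 L 1 U μ - (h : ℂ) • (pairField g L + (pairField g L)ᴴ) := by
  -- the three pulled-back pieces
  have hE : fermionEmbed (PolySite.toTorusEmb L hInj')
      (fermionEmbed (PolySite.incl h0) ((hubbardFermionInteraction 2 1 U).meanEnergyObs 1)) =
      fermionEmbed (PolySite.toTorusEmb L (injOn_proj_thicken_one hL))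
        ((hubbardFermionInteraction 2 1 U).meanEnergyObs 1) :=
    fermionEmbed_toTorusEmb_incl h0 hInj' _
  have hN : ∀ σ : Fin 2, fermionEmbed (PolySite.toTorusEmb L hInj') (nAt 0 hz σ) =
      numberOp (FermionTorus.ofTorusSite (0 : TorusSite 2 L)) σ :=
    fun σ => fermionEmbed_toTorusEmb_nAt_zero hz hInj' σ
  have hproj0 : Torus.proj L (0 : Site 2) = 0 := by funext i; simp [Torus.proj]
  have hΔ : fermionEmbed (PolySite.toTorusEmb L hInj')
      (fermionEmbed (PolySite.incl hP) (localPairAt (insert (0 : Site 2) unitSteps) g 0)) = localPair g L 0 := by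
    rw [fermionEmbed_toTorusEmb_incl hP hInj', fermionEmbed_toTorusEmb_localPairAt,
      localPairOn_insert_zero_unitSteps, hproj0]
  -- translate term by term
  have hstep : ∀ v : TorusSite 2 L, (fockTranslate v).val *
      fermionEmbed (PolySite.toTorusEmb L hInj')
        (fermionEmbed (PolySite.incl h0) ((hubbardFermionInteraction 2 1 U).meanEnergyObs 1) -
          (μ : ℂ) • ∑ σ : Fin 2, nAt 0 hz σ -
          (h : ℂ) • (fermionEmbed (PolySite.incl hP) (localPairAt (insert (0 : Site 2) unitSteps) g 0) +
            (fermionEmbed (PolySite.incl hP) (localPairAt (insert (0 : Site 2) unitSteps) g 0))ᴴ)) *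
        (fockTranslate v).valᴴ =
      relabel (Orb.translate v) (fermionEmbed (PolySite.toTorusEmb L (injOn_proj_thicken_one hL))
          ((hubbardFermionInteraction 2 1 U).meanEnergyObs 1)) -
        (μ : ℂ) • ∑ σ : Fin 2, (fockTranslate v).val *
          numberOp (FermionTorus.ofTorusSite (0 : TorusSite 2 L)) σ * (fockTranslate v).valᴴ -
        (h : ℂ) • (localPair g L (0 + v) + (localPair g L (0 + v))ᴴ) := by
    intro v
    rw [fermionEmbed_sub, fermionEmbed_sub, fermionEmbed_smul, fermionEmbed_smul, fermionEmbed_sum, fermionEmbed_add, fermionEmbed_conjTranspose, hE, hΔ,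
      Finset.sum_congr rfl fun σ _ => hN σ, ← relabel_translate_localPair g v 0]
    simp only [relabel_eq_fockRelabel_conj]
    simp only [Matrix.mul_sub, Matrix.sub_mul, Matrix.mul_smul, Matrix.smul_mul, Matrix.mul_add, Matrix.add_mul,
      Finset.mul_sum, Finset.sum_mul, conjTranspose_mul, conjTranspose_conjTranspose, Matrix.mul_assoc]
  rw [Finset.sum_congr rfl fun v _ => hstep v, Finset.sum_sub_distrib, Finset.sum_sub_distrib,
    sum_relabel_translate_hubbard_meanEnergyObs (d := 2) 1 U hL, ← Finset.smul_sum, ← Finset.smul_sum,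
    Finset.sum_comm, Finset.sum_congr rfl fun σ _ => sum_conj_fockTranslate_numberOp (0 : TorusSite 2 L) σ,
    Finset.sum_add_distrib, ← conjTranspose_sum, hubbardTorusWith_eq, totalNumber, Finset.sum_comm]
  simp only [zero_add, pairField]

/-- **Translation invariance of the sourced torus Hamiltonian**: `U_v A_L = A_L U_v`.
[cite: KomaTasaki1994, §1] -/
theorem fockTranslate_mul_dWaveSourceTorus (v : TorusSite 2 L) (U μ h : ℝ) :
    (fockTranslate v).val * dWaveSourceTorus L U μ h = dWaveSourceTorus L U μ h * (fockTranslate v).val := by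
  refine (fockRelabel_commute_of_relabel_eq _ ?_).eq
  rw [dWaveSourceTorus, relabel_sub, relabel_smul, relabel_add, relabel_conjTranspose,
    relabel_translate_hubbardTorusWith, relabel_translate_pairField]

/-- **`S^z` is conserved by the sourced torus Hamiltonian** (the singlet pair source carries no
`S^z`): `S^z A_L = A_L S^z`. [cite: KomaTasaki1994, §1] -/
theorem spinZ_mul_dWaveSourceTorus (U μ h : ℝ) :
    HubbardWave0.spinZ * dWaveSourceTorus L U μ h = dWaveSourceTorus L U μ h * HubbardWave0.spinZ := by
  have hH : Commute HubbardWave0.spinZ (hubbardTorus 2 L 1 U) :=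
    ((hamiltonian_isHermitian_and_commute_holds (fermionTorusGraph 2 L) 1 U).2.2).symm
  have hN : Commute HubbardWave0.spinZ
      (totalNumber : Matrix (Finset (Orb (FermionTorus 2 L))) (Finset (Orb (FermionTorus 2 L))) ℂ) :=
    spinZ_commute_totalNumber
  have hΔ : Commute HubbardWave0.spinZ (pairField dWaveFormFactor L) :=
    Commute.sum_right _ _ _ fun x _ => spinZ_commute_localPair dWaveFormFactor L x
  have hΔ' : Commute HubbardWave0.spinZ (pairField dWaveFormFactor L)ᴴ := by
    have h1 := congrArg conjTranspose hΔ.eq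
    rw [conjTranspose_mul, conjTranspose_mul, HubbardWave0.spinZ_isHermitian.eq] at h1
    exact h1.symm
  rw [dWaveSourceTorus, hubbardTorusWith_eq]
  exact (((hH.sub_right (hN.smul_right _)).sub_right ((hΔ.add_right hΔ').smul_right _))).eq


end Window

/-! ### The window certificate theorem -/

section Certificate

variable {L : ℕ} [NeZero L]

/-- (Local to this section, as in `HubbardTorusLocalCertificate` / `HubbardWindowCertificate`.) Torus
sites are compared through the linear order, the instance carried by the orbital-generic lemmas; the
instance-independent consumer form is `dWaveSourceTorus_groundEnergy_ge_of_window_certificate_eventually`.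
[folklore] -/
local instance (priority := high) instDecidableEqFermionTorusSrcWindow : DecidableEq (FermionTorus 2 L) :=
  LinearOrder.toDecidableEq

/-- **Window certificate ⇒ ground-state energy of EVERY large pair-sourced Hubbard torus.**
Data: a window `Λ' ⊆ ℤ²` containing `thicken {0} 1` and the pair region of `0` (so that the local
objective `E_Φ(1,U) − μ Σ_σ n_{0σ} − h(Δ₀ + Δ₀ᴴ)`, `Δ₀ = localPairAt {0,±e₁,±e₂} dWaveFormFactor 0`,
lives in `𝔄_{Λ'}`), an inner region `Λ ⊆ Λ'` all of whose lattice neighbours lie in `Λ'`, and an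
identity in `𝔄_{Λ'}`
`E^src − c·1 = Σ Λₐᵦ Oₐᴴ O_b + (Σₖ (H^src_{Λ'} Γ(incl)Bₖ − Γ(incl)Bₖ H^src_{Λ'})
   + Σₗ (Γ(incl)(Γ(τ_{vₗ}) Yₗ) − Γ(incl) Yₗ) + Σⱼ bⱼ • wⱼ) + (Σₘ dₘ • (Vₘᴴ − Vₘ) + Σₖ aₖ • vₖ)`
with `Λ ⪰ 0`, `H^src_{Λ'} = pairSourceWindowHamiltonian dWaveFormFactor Λ' U μ h`, `Bₖ, Yₗ ∈ 𝔄_Λ`,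
translations `vₗ` with `Λ + vₗ ⊆ Λ'`, `S^z`-CHARGED ladder words `wⱼ` (`ladderSpinCharge wⱼ ≠ 0`),
real `dₘ`, ladder words `vₖ`. Then for every torus side `L ≥ 3` with `x ↦ x mod L` injective on
`thicken Λ' 1`: `(c − Σₖ ‖aₖ‖) · L² ≤ E₀(A_L)`, `A_L = dWaveSourceTorus L U μ h`, the ground-state
energy on the full Fock space. Han 2020 §3 (fermionic bootstrap in the thermodynamic limit), read on
the periodic box through its tracial ground state (Bratteli–Robinson II §6.2.4); particle-number-charged
words and point-group reductions are not admissible here. [cite: Han2020Bootstrap, §3] -/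
theorem dWaveSourceTorus_groundEnergy_ge_of_window_certificate (U μ h : ℝ) (hL : 3 ≤ L)
    {Λ Λ' : Finset (Site 2)} (hΛ : Λ ⊆ Λ')
    (hclosed : ∀ x ∈ Λ, ∀ i : Fin 2, x + unitVec i ∈ Λ' ∧ x - unitVec i ∈ Λ')
    (h0 : thicken ({0} : Finset (Site 2)) 1 ⊆ Λ') (hz : (0 : Site 2) ∈ Λ')
    (hP : pairRegion (insert (0 : Site 2) unitSteps) 0 ⊆ Λ')
    (hInj : Set.InjOn (Torus.proj (d := 2) L) ↑(thicken Λ' 1))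
    {m : Type*} [Fintype m] [DecidableEq m] {Λm : Matrix m m ℂ} (hΛm : Λm.PosSemidef)
    (O : m → FermionOp Λ')
    {κ : Type*} (s : Finset κ) (B : κ → FermionOp Λ)
    {ι : Type*} (tt : Finset ι) (v : ι → Site 2) (hsh : ∀ l, shiftSet (v l) Λ ⊆ Λ') (Y : ι → FermionOp Λ)
    {γ : Type*} (u : Finset γ) (b : γ → ℂ) (cw : γ → List (Orb (PolySite Λ') × Bool))
    (hcw : ∀ j ∈ u, ladderSpinCharge (cw j) ≠ 0)
    {δ : Type*} (ah : Finset δ) (dc : δ → ℝ) (V : δ → FermionOp Λ')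
    {κ'' : Type*} (w : Finset κ'') (a : κ'' → ℂ) (word : κ'' → List (Orb (PolySite Λ') × Bool)) {c : ℝ}
    (hcert : fermionEmbed (PolySite.incl h0) ((hubbardFermionInteraction 2 1 U).meanEnergyObs 1) -
          (μ : ℂ) • ∑ σ : Fin 2, nAt 0 hz σ -
          (h : ℂ) • (fermionEmbed (PolySite.incl hP) (localPairAt (insert (0 : Site 2) unitSteps) dWaveFormFactor 0) +
            (fermionEmbed (PolySite.incl hP) (localPairAt (insert (0 : Site 2) unitSteps) dWaveFormFactor 0))ᴴ) -
        (c : ℂ) • (1 : FermionOp Λ') =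
      gramForm Λm O +
        (∑ k ∈ s, (pairSourceWindowHamiltonian dWaveFormFactor Λ' U μ h * fermionEmbed (PolySite.incl hΛ) (B k) -
            fermionEmbed (PolySite.incl hΛ) (B k) * pairSourceWindowHamiltonian dWaveFormFactor Λ' U μ h) +
          ∑ l ∈ tt, (fermionEmbed (PolySite.incl (hsh l)) (fermionEmbed (PolySite.shiftEmb (v l) Λ) (Y l)) -
            fermionEmbed (PolySite.incl hΛ) (Y l)) +
          ∑ j ∈ u, b j • ladderWord (cw j)) +
        (∑ m' ∈ ah, ((dc m' : ℝ) : ℂ) • ((V m')ᴴ - V m') + ∑ k ∈ w, a k • ladderWord (word k))) :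
    (c - ∑ k ∈ w, ‖a k‖) * (L : ℝ) ^ 2 ≤ (dWaveSourceTorus L U μ h).groundEnergy := by
  classical
  -- the pull-back homomorphism and its restriction to the inner region
  have hInj' : Set.InjOn (Torus.proj (d := 2) L) ↑Λ' := hInj.mono (by exact_mod_cast subset_thicken Λ' 1)
  have hInjΛ : Set.InjOn (Torus.proj (d := 2) L) ↑Λ := hInj'.mono (by exact_mod_cast hΛ)
  set Γ' := fermionEmbed (PolySite.toTorusEmb L hInj') with hΓ'
  set ΓΛ := fermionEmbed (PolySite.toTorusEmb L hInjΛ) with hΓΛ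
  set H := dWaveSourceTorus L U μ h with hH
  have hHh : H.IsHermitian :=
    dWaveSourceTorus_isHermitian L (hubbardTorusWith_isHermitian (hamiltonianWith_isHermitian_and_commute_holds _) 1 U μ) h
  -- the objective; its torus translates sum to `A_L`
  set X := Γ' (fermionEmbed (PolySite.incl h0) ((hubbardFermionInteraction 2 1 U).meanEnergyObs 1) -
      (μ : ℂ) • ∑ σ : Fin 2, nAt 0 hz σ -
      (h : ℂ) • (fermionEmbed (PolySite.incl hP) (localPairAt (insert (0 : Site 2) unitSteps) dWaveFormFactor 0) +
        (fermionEmbed (PolySite.incl hP) (localPairAt (insert (0 : Site 2) unitSteps) dWaveFormFactor 0))ᴴ)) with hX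
  set T : TorusSite 2 L → Matrix (Finset (Orb (FermionTorus 2 L))) (Finset (Orb (FermionTorus 2 L))) ℂ :=
    fun v' => (fockTranslate v').val with hT
  have hTH : ∀ v', T v' * H = H * T v' := fun v' => fockTranslate_mul_dWaveSourceTorus L v' U μ h
  have hTT : ∀ v', (T v')ᴴ * T v' = 1 := fun v' => fockTranslate_conjTranspose_mul_self v'
  have hsum : ∑ v', T v' * X * (T v')ᴴ = H := by
    rw [hH, dWaveSourceTorus, hX, hΓ']
    exact sum_conj_fockTranslate_pairSourceObjective dWaveFormFactor L h0 hz hP hInj' hL U μ h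
  -- the sector is the whole Fock space
  have hK : (⊤ : Submodule ℂ (Fock (Orb (FermionTorus 2 L)))) ≠ ⊥ := top_ne_bot
  -- symmetry (translation) family
  set Us : ι → Matrix (Finset (Orb (FermionTorus 2 L))) (Finset (Orb (FermionTorus 2 L))) ℂ :=
    fun l => (fockTranslate (Torus.proj L (v l))).val with hUs
  set Yt : ι → Matrix (Finset (Orb (FermionTorus 2 L))) (Finset (Orb (FermionTorus 2 L))) ℂ :=
    fun l => ΓΛ (Y l) with hYt
  have hU : ∀ l ∈ tt, Us l * H = H * Us l := fun l _ => fockTranslate_mul_dWaveSourceTorus L _ U μ h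
  have hUU : ∀ l ∈ tt, (Us l)ᴴ * Us l = 1 := fun l _ => fockTranslate_conjTranspose_mul_self _
  -- charge family: `S^z`-charged words are commutators with the conserved `S^z`
  set emb : Orb (PolySite Λ') × Bool → Orb (FermionTorus 2 L) × Bool :=
    fun p => (Orb.embMap (PolySite.toTorusEmb L hInj') p.1, p.2) with hemb
  set C : γ → Matrix (Finset (Orb (FermionTorus 2 L))) (Finset (Orb (FermionTorus 2 L))) ℂ :=
    fun _ => HubbardWave0.spinZ with hC
  set W : γ → Matrix (Finset (Orb (FermionTorus 2 L))) (Finset (Orb (FermionTorus 2 L))) ℂ :=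
    fun j => (b j / (((ladderSpinCharge ((cw j).map emb) : ℤ) : ℂ) / 2)) • ladderWord ((cw j).map emb) with hW
  have hC1 : ∀ j ∈ u, C j * H = H * C j := fun _ _ => spinZ_mul_dWaveSourceTorus L U μ h
  have hcharged : ∀ j ∈ u, Γ' (b j • ladderWord (cw j)) = C j * W j - W j * C j := by
    intro j hj
    have hq : (((ladderSpinCharge ((cw j).map emb) : ℤ) : ℂ) / 2) ≠ 0 := by
      rw [hemb, ladderSpinCharge_map_embMap]
      exact div_ne_zero (Int.cast_ne_zero.2 (hcw j hj)) two_ne_zero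
    rw [fermionEmbed_smul, fermionEmbed_ladderWord, hC, hW]
    simp only [Matrix.mul_smul, Matrix.smul_mul]
    rw [← smul_sub, spinZ_comm_ladderWord, smul_smul, div_mul_cancel₀ _ hq]
  -- residual words are contractions
  set M : κ'' → Matrix (Finset (Orb (FermionTorus 2 L))) (Finset (Orb (FermionTorus 2 L))) ℂ :=
    fun k => ladderWord ((word k).map emb) with hM
  have hMc : ∀ k ∈ w, (M k).IsContraction := fun k _ => by
    rw [hM]; dsimp only; rw [ladderWord_eq_prod]; exact isContraction_prod_ladder _
  -- the identity, pulled back into the torus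
  have htorus : X - (c : ℂ) • (1 : Matrix (Finset (Orb (FermionTorus 2 L))) (Finset (Orb (FermionTorus 2 L))) ℂ) =
      gramForm Λm (fun i => Γ' (O i)) +
        (∑ k ∈ s, (H * Γ' (fermionEmbed (PolySite.incl hΛ) (B k)) - Γ' (fermionEmbed (PolySite.incl hΛ) (B k)) * H) +
          ∑ l ∈ tt, (Us l * Yt l * (Us l)ᴴ - Yt l) +
          ∑ i ∈ (∅ : Finset (Fin 0)), ((0 : Matrix _ _ ℂ) * ((0 : Matrix _ _ ℂ) - (((0 : ℝ) : ℝ) : ℂ) • 1) +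
            ((0 : Matrix _ _ ℂ) - (((0 : ℝ) : ℝ) : ℂ) • 1) * (0 : Matrix _ _ ℂ)) +
          ∑ j ∈ u, (C j * W j - W j * C j)) +
        (∑ m' ∈ ah, ((dc m' : ℝ) : ℂ) • ((Γ' (V m'))ᴴ - Γ' (V m')) + ∑ k ∈ w, a k • M k) := by
    have key := congrArg Γ' hcert
    rw [fermionEmbed_sub, fermionEmbed_smul, fermionEmbed_one] at key
    have h1 : Γ' (∑ k ∈ s, (pairSourceWindowHamiltonian dWaveFormFactor Λ' U μ h * fermionEmbed (PolySite.incl hΛ) (B k) -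
        fermionEmbed (PolySite.incl hΛ) (B k) * pairSourceWindowHamiltonian dWaveFormFactor Λ' U μ h)) =
        ∑ k ∈ s, (H * Γ' (fermionEmbed (PolySite.incl hΛ) (B k)) - Γ' (fermionEmbed (PolySite.incl hΛ) (B k)) * H) := by
      rw [fermionEmbed_sum]
      refine Finset.sum_congr rfl fun k _ => ?_
      rw [hH, hΓ', dWaveSourceTorus_commutator_fermionEmbed L hΛ hclosed hInj U μ h (B k)]
    have h2 : Γ' (∑ l ∈ tt, (fermionEmbed (PolySite.incl (hsh l)) (fermionEmbed (PolySite.shiftEmb (v l) Λ) (Y l)) -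
        fermionEmbed (PolySite.incl hΛ) (Y l))) = ∑ l ∈ tt, (Us l * Yt l * (Us l)ᴴ - Yt l) := by
      rw [fermionEmbed_sum]
      refine Finset.sum_congr rfl fun l _ => ?_
      rw [hUs, hYt, hΓΛ]
      exact fermionEmbed_toTorusEmb_shift_sub hΛ (v l) (hsh l) hInj' (Y l)
    have h3 : Γ' (∑ j ∈ u, b j • ladderWord (cw j)) = ∑ j ∈ u, (C j * W j - W j * C j) := by
      rw [fermionEmbed_sum]
      exact Finset.sum_congr rfl hcharged
    have h4 : Γ' (∑ m' ∈ ah, ((dc m' : ℝ) : ℂ) • ((V m')ᴴ - V m')) =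
        ∑ m' ∈ ah, ((dc m' : ℝ) : ℂ) • ((Γ' (V m'))ᴴ - Γ' (V m')) := by
      rw [fermionEmbed_sum]
      refine Finset.sum_congr rfl fun m' _ => ?_
      rw [fermionEmbed_smul, fermionEmbed_sub, hΓ', fermionEmbed_conjTranspose]
    have h5 : Γ' (∑ k ∈ w, a k • ladderWord (word k)) = ∑ k ∈ w, a k • M k := by
      rw [fermionEmbed_sum]
      refine Finset.sum_congr rfl fun k _ => ?_
      rw [fermionEmbed_smul, hM, fermionEmbed_ladderWord]
    rw [hX, key, fermionEmbed_add, fermionEmbed_add, fermionEmbed_add, fermionEmbed_add, fermionEmbed_add, hΓ',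
      fermionEmbed_gramForm, ← hΓ', h1, h2, h3, h4, h5, Finset.sum_empty, add_zero]
  -- the symmetric local-certificate theorem on the whole Fock space
  have hmain := Matrix.mul_card_le_minEnergyOn_of_local_certificate hHh ⊤ (fun _ _ => Submodule.mem_top) hK
    X T hTH (fun _ _ _ => Submodule.mem_top) (fun _ _ _ => Submodule.mem_top) hTT hsum hΛm
    (fun i => Γ' (O i)) s (fun k => Γ' (fermionEmbed (PolySite.incl hΛ) (B k))) tt Us Yt hU
    (fun _ _ _ _ => Submodule.mem_top) (fun _ _ _ _ => Submodule.mem_top) hUU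
    (∅ : Finset (Fin 0)) (fun _ => 0) (fun _ => 0) (fun _ => 0) (fun _ => 0)
    (fun i hi => absurd hi (Finset.notMem_empty i)) (fun i hi => absurd hi (Finset.notMem_empty i))
    u C W hC1 (fun _ _ _ _ => Submodule.mem_top) (fun _ _ _ _ => Submodule.mem_top)
    ah dc (fun m' => Γ' (V m')) w a M hMc htorus
  rw [card_torusSite, Matrix.minEnergyOn_top_holds hHh] at hmain
  exact_mod_cast hmain

end Certificate

/-- **Eventual form, in the shape of the certificate consumers** (`PairSourceEnergyCertAlong.ofEnergyRows`,
input `hlo : ∀ L ≥ L₀, e_lo · L² ≤ E₀(A_L)` of the `Summit.HubbardSuperconductivity.HubbardLadder` cell):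
with the data of `dWaveSourceTorus_groundEnergy_ge_of_window_certificate` (an identity in the window,
independent of `L`), there is `L₀` with `(c − Σₖ ‖aₖ‖) · L² ≤ E₀(dWaveSourceTorus L U μ h)` for
every `L ≥ L₀` (`L₀ = max 3 L₁`, `L₁` from `exists_forall_le_injOn_proj (thicken Λ' 1)`), stated with the
library instances found at the concrete torus (no local instance in force here).
[cite: Han2020Bootstrap, §3] -/
theorem dWaveSourceTorus_groundEnergy_ge_of_window_certificate_eventually (U μ h : ℝ)
    {Λ Λ' : Finset (Site 2)} (hΛ : Λ ⊆ Λ')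
    (hclosed : ∀ x ∈ Λ, ∀ i : Fin 2, x + unitVec i ∈ Λ' ∧ x - unitVec i ∈ Λ')
    (h0 : thicken ({0} : Finset (Site 2)) 1 ⊆ Λ') (hz : (0 : Site 2) ∈ Λ')
    (hP : pairRegion (insert (0 : Site 2) unitSteps) 0 ⊆ Λ')
    {m : Type*} [Fintype m] [DecidableEq m] {Λm : Matrix m m ℂ} (hΛm : Λm.PosSemidef)
    (O : m → FermionOp Λ')
    {κ : Type*} (s : Finset κ) (B : κ → FermionOp Λ)
    {ι : Type*} (tt : Finset ι) (v : ι → Site 2) (hsh : ∀ l, shiftSet (v l) Λ ⊆ Λ') (Y : ι → FermionOp Λ)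
    {γ : Type*} (u : Finset γ) (b : γ → ℂ) (cw : γ → List (Orb (PolySite Λ') × Bool))
    (hcw : ∀ j ∈ u, ladderSpinCharge (cw j) ≠ 0)
    {δ : Type*} (ah : Finset δ) (dc : δ → ℝ) (V : δ → FermionOp Λ')
    {κ'' : Type*} (w : Finset κ'') (a : κ'' → ℂ) (word : κ'' → List (Orb (PolySite Λ') × Bool)) {c : ℝ}
    (hcert : fermionEmbed (PolySite.incl h0) ((hubbardFermionInteraction 2 1 U).meanEnergyObs 1) -
          (μ : ℂ) • ∑ σ : Fin 2, nAt 0 hz σ -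
          (h : ℂ) • (fermionEmbed (PolySite.incl hP) (localPairAt (insert (0 : Site 2) unitSteps) dWaveFormFactor 0) +
            (fermionEmbed (PolySite.incl hP) (localPairAt (insert (0 : Site 2) unitSteps) dWaveFormFactor 0))ᴴ) -
        (c : ℂ) • (1 : FermionOp Λ') =
      gramForm Λm O +
        (∑ k ∈ s, (pairSourceWindowHamiltonian dWaveFormFactor Λ' U μ h * fermionEmbed (PolySite.incl hΛ) (B k) -
            fermionEmbed (PolySite.incl hΛ) (B k) * pairSourceWindowHamiltonian dWaveFormFactor Λ' U μ h) +
          ∑ l ∈ tt, (fermionEmbed (PolySite.incl (hsh l)) (fermionEmbed (PolySite.shiftEmb (v l) Λ) (Y l)) -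
            fermionEmbed (PolySite.incl hΛ) (Y l)) +
          ∑ j ∈ u, b j • ladderWord (cw j)) +
        (∑ m' ∈ ah, ((dc m' : ℝ) : ℂ) • ((V m')ᴴ - V m') + ∑ k ∈ w, a k • ladderWord (word k))) :
    ∃ L₀ : ℕ, ∀ (L : ℕ) [NeZero L], L₀ ≤ L →
      (c - ∑ k ∈ w, ‖a k‖) * (L : ℝ) ^ 2 ≤ (dWaveSourceTorus L U μ h).groundEnergy := by
  obtain ⟨L₁, hL₁⟩ := exists_forall_le_injOn_proj (thicken Λ' 1)
  refine ⟨max 3 L₁, fun L _ hL => ?_⟩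
  -- the two `DecidableEq (FermionTorus 2 L)` instances agree by `Subsingleton.elim`
  convert dWaveSourceTorus_groundEnergy_ge_of_window_certificate U μ h (le_trans (le_max_left _ _) hL) hΛ
    hclosed h0 hz hP (hL₁ L (le_trans (le_max_right _ _) hL)) hΛm O s B tt v hsh Y u b cw hcw ah dc V w a
    word hcert using 2

end Literature.MathematicalPhysics.QuantumLattice
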